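import Summits.CriticalPhenomena.PercolationContinuityZ3.Theorems.PercNearOneGluingAdditiveGluingPairStepOdds
import Summits.CriticalPhenomena.PercolationContinuityZ3.Theorems.PercNearOneGluingAdditiveGluingKnThm2GoodEvents
import HarnessLib

/-! # Crux `PercNearOneGluing.AdditiveGluing` (stmt-CriticalPhenomena-4576), line `peel`, stub `stub_toolHijackRide_c5` —
# tool T1′: the winning designated relay carries the bystander at least as often as the losing one

Support file (`--supports stmt-CriticalPhenomena-4576`); no definitions, no named facts.

`μ = prodBernoulli u` on the bond configurations of the complete weighted graph `Fin n`; `a₀` the designated relay,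
`b` the target, `s` the observer, `x` a bystander; `LOSE = μ(a₀↔b, s↮b)`, `WIN = μ(s↔b, a₀↮b)`,
`Hij₂ = μ(s↔b, a₀↮b, x↔a₀)` (`s` wins, `x` attached to the losing relay), `Hij′ = μ(a₀↔b, s↮b, x↔a₀)` (`a₀` wins and
`x` rides it).
* `stub_toolHijackRide_c5` (**tool T1′** of the Kozma–Nitzan pair step): `LOSE · Hij₂ ≤ WIN · Hij′`.
  This is the landed one-relay inequality `pairStep_winner_attracts` ("the winner's cluster attracts the bystander",
  BHK 2006 Thms 1.3–1.4 = KN Lemma 1 twice) after the event identifications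
  `{a₀↔b} ∩ {s↮b} = {a₀↮s} ∩ {a₀↔b}` and `{s↔b} ∩ {a₀↮b} = {a₀↮s} ∩ {s↔b}` (`pairStep_win_eq`) and `{x↔a₀} = {a₀↔x}`.
[cite: VandenbergHaggstromKahn2005, Thm. 1.3 (p. 6), Thm. 1.4 (p. 7); KozmaNitzan2024, Lemma 1 (pp. 5–6), §3.2 pp. 12–14]
-/

namespace Summit.CriticalPhenomena.PercolationContinuityZ3.Theorems

open MeasureTheory Set
open Literature.Probability.LatticeModels (prodBernoulli)
open Literature.Probability.Percolation (BondConfig openConn openConnIn openGraph openCluster)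
open scoped BigOperators Classical
noncomputable section

section ToolHijackRide

variable {n : ℕ}

/-- **Tool T1′ — the winning designated relay carries the bystander** (registered stub `stub_toolHijackRide_c5` of the
line `peel`): for `a₀ ≠ s`,
`μ(a₀↔b ∩ s↮b) · μ(s↔b ∩ a₀↮b ∩ x↔a₀) ≤ μ(s↔b ∩ a₀↮b) · μ(a₀↔b ∩ s↮b ∩ x↔a₀)`.
On `{a₀↔b}` one has `s↮b ⟺ a₀↮s`, and on `{s↔b}` one has `a₀↮b ⟺ a₀↮s` (`pairStep_win_eq`), so both sides are the
two sides of `pairStep_winner_attracts u a₀ s x b` (conditioning event `{a₀ ↮ s}`).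
[cite: VandenbergHaggstromKahn2005, Thm. 1.3 (p. 6), Thm. 1.4 (p. 7); KozmaNitzan2024, Lemma 1 (pp. 5–6), §3.2 pp. 12–14] -/
theorem stub_toolHijackRide_c5 :
    ∀ (n : ℕ) (u : Sym2 (Fin n) → unitInterval) (b a₀ s x : Fin n),
      a₀ ≠ s →
      (prodBernoulli u).real (openConn a₀ b ∩ (openConn s b)ᶜ)
          * (prodBernoulli u).real (openConn s b ∩ (openConn a₀ b)ᶜ ∩ openConn x a₀)
        ≤ (prodBernoulli u).real (openConn s b ∩ (openConn a₀ b)ᶜ)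
          * (prodBernoulli u).real (openConn a₀ b ∩ (openConn s b)ᶜ ∩ openConn x a₀) := by
  intro n u b a₀ s x ha₀s
  -- `{a₀↔b} ∩ {s↮b} = {a₀↮s} ∩ {a₀↔b}`, `{s↔b} ∩ {a₀↮b} = {s↮a₀} ∩ {s↔b}`, then symmetrise `s↮a₀`, `x↔a₀`
  rw [pairStep_win_eq a₀ s b, pairStep_win_eq s a₀ b, knThm2_openConn_comm s a₀, knThm2_openConn_comm x a₀]
  exact pairStep_winner_attracts u a₀ s x b ha₀s

end ToolHijackRide

end

end Summit.CriticalPhenomena.PercolationContinuityZ3.Theorems
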